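import Summits.BirchSwinnertonDyer.BirchSwinnertonDyer.Theses.CycTangentCM
import Literature.NumberTheory.EllipticCurves.DeShalit1987.KatzMeasureMonomialLinesPAdic
import HarnessLib

/-!
# Crux `CycTangentCM.CycTangentBound` (stmt-BirchSwinnertonDyer-22628): the LINE INEQUALITY it implies —
# `λ̄_cyc ≤ λ̄(ℓ) + 1` for EVERY line `ℓ` through the origin of the two-variable frame — and the kernel form
# of the line's kill criterion (`--supports 22628`; nothing is closed)

Seat `prover-bsd-line-ctcm-p3` (D-0145 line `route-BirchSwinnertonDyer-CycTangentCM`, prover 3/3), for the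
lead's falsifier road (`Cruxes/CycTangentBound/Lines/tangent_cone_parity_falsifier.md`: "KILL(A, p): λ_p(A) ≥
λ̄_N + 2 … UPPER BOUND for m₀ WITHOUT two-variable numerics: for EVERY `ℤ_p`-line `ℓ` … `m₀ ≤ λ̄(G|_ℓ)`").

The crux says: a unit coefficient `[T₁^iT₂^j]G` forces a unit coefficient of the inner (cyclotomic) line
`G(0,T₂) = constantCoeff G` in degree `≤ i + j + 1` ("`λ̄_cyc ≤ m₀ + 1`").  The invariant `m₀` (least total
degree of a unit coefficient of `G`) is not observable, but the tree now has, for every formal curve through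
the origin and in particular every MONOMIAL LINE `G((1+T)^{c₁} − 1, (1+T)^{c₂} − 1)` (`IntSeries.monomialLine`,
`DeShalit1987/KatzMeasureMonomialLines*.lean`; for a `ℤ_p`-quotient `κ` through the pair and `cᵢ = κ(γᵢ)` this
is the `κ`-BRANCH of the measure, `IsKatzMeasure₂.isKatzBranch_monomialLine`), the kernel inequality
`m₀ ≤ λ̄(ℓ)`: a unit coefficient of the line in degree `n` comes from a unit `[T₁^iT₂^j]G` with `i + j ≤ n`
(`IntSeries.exists_isUnit_coeff_coeff_of_isUnit_coeff_monomialLine`).  Eliminating `m₀`: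

* `exists_isUnit_coeff_constantCoeff_of_monomialLine` (pure algebra in the receptacle): if `G` satisfies the
  crux's conclusion (for all `(i, j)`), then for every `(c₁, c₂) ∈ ℤ_p²` and `n`, a unit coefficient of
  `monomialLine c₁ c₂ G` in degree `n` forces a unit coefficient of `constantCoeff G` in degree `≤ n + 1`;
* `cycTangentBound_lineInequality` — `CycTangentBound` BY NAME implies, in every frame of the crux, the
  **two-line inequality `λ̄_cyc ≤ λ̄(ℓ) + 1`** for every monomial line `ℓ = (c₁, c₂)`;
* `not_cycTangentBound_of_lineGap` — the KILL CRITERION in kernel form: ONE frame of the crux together with a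
  monomial line `(c₁, c₂)` and a degree `n` such that the line has a unit coefficient in degree `n` while
  `constantCoeff G` has NO unit coefficient in degree `≤ n + 1` ("`λ̄_cyc ≥ λ̄(ℓ) + 2`") REFUTES `CycTangentBound`.
  The witness frame is not constructible in the tree (it needs the cite-only frame facts de Shalit II.4.17 /
  Deuring); this is the `<Decl>_false_of_<H>` shape with `H` = such a gap witness — what a certified row of the
  lead's instrument (λ_p(A) from modular symbols, λ̄_N from the Damerell values `e(t)` on the split-prime line
  `N_∞`) supplies at the paper level.

No definition, no named fact, no `sorry`; BSD is not proved or refuted by any of this, and K6's crux 19234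
(`μ_cyc = 0`) is untouched by either outcome.

References: [deShalit1987] II.4.17 (51)–(54); [Cuoco1982], [Monsky1981] (directional `λ`-invariants: `λ(ℓ) = m₀`
off finitely many exceptional directions — only the trivial inequality is used here).
-/

-- the summit namespace `Summit.BirchSwinnertonDyer.BirchSwinnertonDyer` repeats the problem name by design (D-0017)
set_option linter.dupNamespace false
set_option autoImplicit false

noncomputable section

open Literature.NumberTheory.GaloisRepresentations
open Literature.NumberTheory.EllipticCurves
open Literature.NumberTheory.EllipticCurves.GreenbergVatsal2000

namespace Summit.BirchSwinnertonDyer.BirchSwinnertonDyer.Theorems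

section Algebra

variable {p : ℕ} [Fact p.Prime]

/-- **`m₀` eliminated (pure algebra in `𝒪_{ℂ_p}⟦T₁⟧⟦T₂⟧`).** If `G` has the tangent-cone property of the crux —
every unit coefficient `[T₁^iT₂^j]G` comes with a unit coefficient of `constantCoeff G` in degree `≤ i+j+1` —
then for every monomial line `(c₁, c₂) ∈ ℤ_p²`: a unit coefficient of `G((1+T)^{c₁} − 1, (1+T)^{c₂} − 1)` in
degree `n` forces a unit coefficient of `constantCoeff G` in degree `≤ n + 1` (the line's unit coefficient comes
from some unit `[T₁^iT₂^j]G` with `i + j ≤ n`, `IntSeries.exists_isUnit_coeff_coeff_of_isUnit_coeff_monomialLine`). -/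
theorem exists_isUnit_coeff_constantCoeff_of_monomialLine {G : PowerSeries (PowerSeries (PadicComplexInt p))}
    (hG : ∀ i j : ℕ, IsUnit (PowerSeries.coeff j (PowerSeries.coeff i G)) →
      ∃ n : ℕ, n ≤ i + j + 1 ∧ IsUnit (PowerSeries.coeff n (PowerSeries.constantCoeff G)))
    {c₁ c₂ : ℤ_[p]} {n : ℕ} (h : IsUnit (PowerSeries.coeff n (IntSeries.monomialLine c₁ c₂ G))) :
    ∃ m : ℕ, m ≤ n + 1 ∧ IsUnit (PowerSeries.coeff m (PowerSeries.constantCoeff G)) := by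
  obtain ⟨i, j, hij, hu⟩ := IntSeries.exists_isUnit_coeff_coeff_of_isUnit_coeff_monomialLine h
  obtain ⟨m, hm, hmu⟩ := hG i j hu
  exact ⟨m, by omega, hmu⟩

end Algebra

/-- **`CycTangentBound ⟹ λ̄_cyc ≤ λ̄(ℓ) + 1` for every monomial line `ℓ`.** In every frame of the crux (all its
binders, by name) and for every `(c₁, c₂) ∈ ℤ_p²`: if the line `G((1+T)^{c₁} − 1, (1+T)^{c₂} − 1)` has a unit
coefficient in degree `n` then the cyclotomic inner line `constantCoeff G` has one in degree `≤ n + 1`.  For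
`(c₁, c₂) = (κ(γ₁), κ(γ₂))`, `κ` a `ℤ_p`-quotient through the pair, the line is the `κ`-branch of the measure
(`IsKatzMeasure₂.isKatzBranch_monomialLine`), e.g. the Katz `ψ`-power line `N_∞` of the lead's instrument. -/
theorem cycTangentBound_lineInequality
    (hC : Summit.BirchSwinnertonDyer.BirchSwinnertonDyer.Theses.CycTangentCM.CycTangentBound) :
    ∀ (A : WeierstrassCurve ℚ) [A.IsElliptic] [A.IsGloballyMinimal] (p : ℕ) [Fact p.Prime], 5 ≤ p →
      A.j ∈ Literature.NumberTheory.EllipticCurves.maximalCMJInvariants → A.HasGoodReductionAtPrime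
      p → ¬ (p : ℤ) ∣ A.frobeniusTrace p → A.HasIrreducibleModPGaloisRep p → ∀ (K : Type) [Field K]
      [NumberField K], Literature.NumberTheory.EllipticCurves.IsCMFieldOfJ K A.j → ∀ (ψ :
      Literature.NumberTheory.GaloisRepresentations.HeckeCharacter K), ψ.HasInfinityType (fun _ ↦
      1) (fun _ ↦ 0) → (∀ s : ℂ, 3 / 2 < s.re →
      Literature.NumberTheory.GaloisRepresentations.heckeLFunction ψ s = A.LSeries s) → ∀ (ι :
      PadicAlgCl p ≃+* ℂ) (v vbar : IsDedekindDomain.HeightOneSpectrum (NumberField.RingOfIntegers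
      K)), ((p : ℕ) : NumberField.RingOfIntegers K) ∈ v.asIdeal → ((p : ℕ) :
      NumberField.RingOfIntegers K) ∈ vbar.asIdeal → vbar ≠ v → (∀ (w : NumberField.InfinitePlace
      K) (k : NumberField.RingOfIntegers K), k ∈ v.asIdeal ↔ ‖ι.symm (w.embedding (k : K))‖ < 1) →
      ∀ (S : Finset (IsDedekindDomain.HeightOneSpectrum (NumberField.RingOfIntegers K))), v ∉ S →
      vbar ∉ S → (∀ w ∈ S, ¬ ψ.IsUnramifiedAt w) → (∀ w : IsDedekindDomain.HeightOneSpectrum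
      (NumberField.RingOfIntegers K), w ∉ S → ψ.IsUnramifiedAt w) → ∀ (κ₁ κ₂ :
      Literature.NumberTheory.EllipticCurves.ZpExtension K p) (γ₁ γ₂ : Field.absoluteGaloisGroup
      K), Literature.NumberTheory.EllipticCurves.ZpExtension.IsTopGeneratorPair κ₁ κ₂ γ₁ γ₂ →
      κ₂.IsCyclotomic → (∃ ζ : (PadicInt p)ˣ, IsOfFinOrder ζ ∧
      ((Literature.NumberTheory.GaloisRepresentations.GaloisRep.cyclotomicCharacter K p γ₂ * ζ :
      (PadicInt p)ˣ) : PadicInt p) = (Literature.NumberTheory.EllipticCurves.cyclotomicGenerator p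
      : PadicInt p)) → ∀ (Ω δ : ℂ) (Ωp : PadicComplex p), Ω ≠ 0 → Ωp ≠ 0 → (δ ^ 2 =
      (NumberField.discr K : ℂ) ∨ δ ^ 2 = -(NumberField.discr K : ℂ)) → ∀ (G : PowerSeries
      (PowerSeries (PadicComplexInt p))), Literature.NumberTheory.EllipticCurves.IsKatzMeasure₂ ι v
      vbar S κ₁ κ₂ γ₁ γ₂ ψ⁻¹ Ω δ Ωp G →
      ∀ (c₁ c₂ : ℤ_[p]) (n : ℕ), IsUnit (PowerSeries.coeff n (IntSeries.monomialLine c₁ c₂ G)) →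
      ∃ m : ℕ, m ≤ n + 1 ∧ IsUnit (PowerSeries.coeff m (PowerSeries.constantCoeff G)) := by
  intro A _ _ p _ hp hj hgood hord hirr K _ _ hK ψ hψ hL ι v vbar hv hvbar hne hι S hvS hvbarS hSram hSunr κ₁ κ₂
    γ₁ γ₂ hpair hcyc hγ₂ Ω δ Ωp hΩ hΩp hδ G hG c₁ c₂ n h
  exact exists_isUnit_coeff_constantCoeff_of_monomialLine (hC A p hp hj hgood hord hirr K hK ψ hψ hL ι v vbar hv
    hvbar hne hι S hvS hvbarS hSram hSunr κ₁ κ₂ γ₁ γ₂ hpair hcyc hγ₂ Ω δ Ωp hΩ hΩp hδ G hG) h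

/-- **The kill criterion in kernel form: a LINE GAP refutes `CycTangentBound`.**  A frame of the crux (all its
binders) with a monomial line `(c₁, c₂)` and a degree `n` such that the line has a unit coefficient in degree
`n` while `constantCoeff G` has no unit coefficient in degree `≤ n + 1` ("`λ̄_cyc ≥ λ̄(ℓ) + 2`") contradicts
`CycTangentBound`.  The shape `CycTangentBound_false_of_<H>`: `H` (the gap witness) is not constructible in the
tree; it is what a certified row of the lead's instrument supplies on paper. -/
theorem not_cycTangentBound_of_lineGap :
    ∀ (A : WeierstrassCurve ℚ) [A.IsElliptic] [A.IsGloballyMinimal] (p : ℕ) [Fact p.Prime], 5 ≤ p →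
      A.j ∈ Literature.NumberTheory.EllipticCurves.maximalCMJInvariants → A.HasGoodReductionAtPrime
      p → ¬ (p : ℤ) ∣ A.frobeniusTrace p → A.HasIrreducibleModPGaloisRep p → ∀ (K : Type) [Field K]
      [NumberField K], Literature.NumberTheory.EllipticCurves.IsCMFieldOfJ K A.j → ∀ (ψ :
      Literature.NumberTheory.GaloisRepresentations.HeckeCharacter K), ψ.HasInfinityType (fun _ ↦
      1) (fun _ ↦ 0) → (∀ s : ℂ, 3 / 2 < s.re →
      Literature.NumberTheory.GaloisRepresentations.heckeLFunction ψ s = A.LSeries s) → ∀ (ι :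
      PadicAlgCl p ≃+* ℂ) (v vbar : IsDedekindDomain.HeightOneSpectrum (NumberField.RingOfIntegers
      K)), ((p : ℕ) : NumberField.RingOfIntegers K) ∈ v.asIdeal → ((p : ℕ) :
      NumberField.RingOfIntegers K) ∈ vbar.asIdeal → vbar ≠ v → (∀ (w : NumberField.InfinitePlace
      K) (k : NumberField.RingOfIntegers K), k ∈ v.asIdeal ↔ ‖ι.symm (w.embedding (k : K))‖ < 1) →
      ∀ (S : Finset (IsDedekindDomain.HeightOneSpectrum (NumberField.RingOfIntegers K))), v ∉ S →
      vbar ∉ S → (∀ w ∈ S, ¬ ψ.IsUnramifiedAt w) → (∀ w : IsDedekindDomain.HeightOneSpectrum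
      (NumberField.RingOfIntegers K), w ∉ S → ψ.IsUnramifiedAt w) → ∀ (κ₁ κ₂ :
      Literature.NumberTheory.EllipticCurves.ZpExtension K p) (γ₁ γ₂ : Field.absoluteGaloisGroup
      K), Literature.NumberTheory.EllipticCurves.ZpExtension.IsTopGeneratorPair κ₁ κ₂ γ₁ γ₂ →
      κ₂.IsCyclotomic → (∃ ζ : (PadicInt p)ˣ, IsOfFinOrder ζ ∧
      ((Literature.NumberTheory.GaloisRepresentations.GaloisRep.cyclotomicCharacter K p γ₂ * ζ :
      (PadicInt p)ˣ) : PadicInt p) = (Literature.NumberTheory.EllipticCurves.cyclotomicGenerator p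
      : PadicInt p)) → ∀ (Ω δ : ℂ) (Ωp : PadicComplex p), Ω ≠ 0 → Ωp ≠ 0 → (δ ^ 2 =
      (NumberField.discr K : ℂ) ∨ δ ^ 2 = -(NumberField.discr K : ℂ)) → ∀ (G : PowerSeries
      (PowerSeries (PadicComplexInt p))), Literature.NumberTheory.EllipticCurves.IsKatzMeasure₂ ι v
      vbar S κ₁ κ₂ γ₁ γ₂ ψ⁻¹ Ω δ Ωp G →
      ∀ (c₁ c₂ : ℤ_[p]) (n : ℕ), IsUnit (PowerSeries.coeff n (IntSeries.monomialLine c₁ c₂ G)) →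
      (∀ m : ℕ, m ≤ n + 1 → ¬ IsUnit (PowerSeries.coeff m (PowerSeries.constantCoeff G))) →
      ¬ Summit.BirchSwinnertonDyer.BirchSwinnertonDyer.Theses.CycTangentCM.CycTangentBound := by
  intro A _ _ p _ hp hj hgood hord hirr K _ _ hK ψ hψ hL ι v vbar hv hvbar hne hι S hvS hvbarS hSram hSunr κ₁ κ₂
    γ₁ γ₂ hpair hcyc hγ₂ Ω δ Ωp hΩ hΩp hδ G hG c₁ c₂ n h hgap hC
  obtain ⟨m, hm, hmu⟩ := cycTangentBound_lineInequality hC A p hp hj hgood hord hirr K hK ψ hψ hL ι v vbar hv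
    hvbar hne hι S hvS hvbarS hSram hSunr κ₁ κ₂ γ₁ γ₂ hpair hcyc hγ₂ Ω δ Ωp hΩ hΩp hδ G hG c₁ c₂ n h
  exact hgap m hm hmu

end Summit.BirchSwinnertonDyer.BirchSwinnertonDyer.Theorems
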